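import Literature.AlgebraicGeometry.Motives.HodgeLieProductSimpleFactor
import Literature.AlgebraicGeometry.Motives.HodgeLieOfAbelianVarietySemisimpleTimesCM
import Literature.AlgebraicGeometry.HodgeTheory.RealMultiplicationHodgeLieAlgebra
import Literature.AlgebraicGeometry.HodgeTheory.GenericAbelianSurfacePowersHodgeClasses
import Literature.AlgebraicGeometry.HodgeTheory.SimpleAbelianSurfacePowersHodgeClasses
import Summits.HodgeConjecture.CorCM.MumfordTateRankFourDivisorClasses
import Summits.HodgeConjecture.CorCM.MumfordTateRankEqHodgeLieRankAddOne
import Summits.HodgeConjecture.CorCM.HodgeLieAlgebraReductive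
import Literature.AlgebraicGeometry.Motives.HodgeLieOfAbelianVarietyBiproduct
import Literature.Algebra.Lie.SemisimpleDimensionThreeSimple
import HarnessLib

/-!
# `dim MT(H¹(X₁ × X₂)) + 1 = dim MT(H¹X₁) + dim MT(H¹X₂)` for `Θ`-rigid factors with a simple `Lie Hg(H¹X₁)`
# (Moonen–Zarhin 1999 §3 (3.1) + Goursat, for the Lie algebras); the rigid factors: non-CM of rank `4`, RM surfaces, `End⁰ = ℚ` surfaces

COR-CM (cell `pub-hodgecm2`, seat `b27` gen 47, count-neutral Mumford–Tate-rank ladder; theorems only, no definition, no named fact;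
UNCONDITIONAL — nothing here uses or asserts HC_CM).  The complex-abelian-variety reading of `Motives/HodgeLieProductSimpleFactor`:
`Hg(X₁ × X₂) ⊆ Hg(X₁) × Hg(X₂)` with surjective projections (Moonen–Zarhin (3.1)), and Goursat's lemma when `Lie Hg(H¹X₁)` is simple.
The surjectivity of the projections is supplied, for the tree's `hodgeLie`, by the `Θ`-RIGIDITY of the factor: every bracket-closed
rational subspace of `Lie Hg(H¹X_i)` whose complex span contains a Hodge operator of `H¹(X_i)` is all of `Lie Hg(H¹X_i)`.

* §1 `Θ`-rigid factors (from the tree's `Θ`-subalgebra theorems): **`hodgeLie_rigid_of_not_isOfCMType_of_mtRank_le_four`** (non-CM `X`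
  with `dim MT(H¹X) ≤ 4`: non-CM elliptic curves, QM surfaces, their powers — `HodgeThetaSubalgebraRankThree`),
  **`hodgeLie_rigid_of_surface_of_finrank_endAlgebra_eq_one`** (surfaces with `End⁰ = ℚ`, `Hg = Sp₄` — `…SymplecticRankFour`),
  **`hodgeLie_rigid_of_isSimple_surface_of_finrank_endAlgebra_eq_two`** (simple surfaces with real multiplication, `Hg = R_{K/ℚ} SL₂` —
  `…RealPlacesSl2` through `HodgeTheory/RealMultiplicationHodgeLieAlgebra`).
* §2 **`finrank_hodgeLie_hodge_one_prod_eq_add_of_rigid`** — for `Θ`-rigid `X₁`, `X₂` with `Lie Hg(H¹X₁)` simple and EITHER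
  `Lie Hg(H¹X₂)` simple of a different dimension OR `Lie Hg(H¹X₂)` semisimple with `dim Lie Hg(H¹X₂) − dim Lie Hg(H¹X₁) ∈ {1,2,4,5,7}`:
  `dim Lie Hg(H¹(X₁ × X₂)) = dim Lie Hg(H¹X₁) + dim Lie Hg(H¹X₂)`; **`mtRank_hodge_one_add_one_eq_add_of_isIsogenous_prod_of_rigid`** —
  `t(X) + 1 = t(X₁) + t(X₂)` for every `X ∼ X₁ × X₂`; §4 `finrank_hodgeLie_hodge_one_prod_eq_add_of_rigid_of_forall_ideal` — the same under
  the bare hypothesis «`Lie Hg(H¹X₂)` has no ideal of codimension `dim Lie Hg(H¹X₁)`» (for reductive non-semisimple second factors).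
The table of `CorCM/MumfordTateRankCurveTimesSurface` (`E × S`: `10` for RM surfaces, `14` for `End⁰S = ℚ`) is the first use.

## References
* [MoonenZarhin1999LowDim] B. Moonen, Yu. G. Zarhin, *Hodge classes on abelian varieties of low dimension*, Math. Ann. 315 (1999),
  §2 (2.1)–(2.2), §3 (3.1) [corpus: paper:arxiv-math_9901113 pp. 5–6]. [cite: MoonenZarhin1999LowDim, §3 (3.1)]
* [Hazama1983] F. Hazama, Tôhoku Math. J. 35 (1983), Lemma (3.1) (Goursat) and §3. [cite: Hazama1983, Lemma (3.1)]
* [Deligne1982HodgeCycles] P. Deligne, LNM 900 (1982), I §3.1 and Prop. 3.4. [cite: Deligne1982HodgeCycles, I §3.1 and Prop. 3.4]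
-/

noncomputable section

open scoped TensorProduct
open CategoryTheory CategoryTheory.Limits Module

namespace Summit.HodgeConjecture.CorCM

open Literature.AlgebraicGeometry.Motives
open Literature.AlgebraicGeometry.Motives.AbelianVariety
open Literature.AlgebraicGeometry.Motives.HodgeStructure
open Literature.AlgebraicGeometry.HodgeTheory
open Literature.AlgebraicGeometry.ComplexMultiplication (EndField)
open Literature.AlgebraicGeometry.Milne1999 (IsOfCMType)

variable [HodgeTensorFacts.{0, 0}] {X X₁ X₂ : AbelianVariety ℂ} {n n₁ n₂ : ℕ}

/-! ## §1 `Θ`-rigid factors -/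

/-- **A non-CM abelian variety with `dim MT(H¹X) ≤ 4` is `Θ`-rigid** (`Lie Hg(H¹X)` is a `ℚ`-form of `𝔰𝔩₂` not contained in
`End_Hdg`; e.g. a non-CM elliptic curve, a QM surface): every bracket-closed rational subspace of `Lie Hg(H¹X)` whose complex span
contains a Hodge operator of `H¹(X)` is `Lie Hg(H¹X)` — the tree's `Θ`-subalgebra theorem in rank three.
[cite: MoonenZarhin1999LowDim, §2 (2.1)–(2.2)] [cite: Deligne1982HodgeCycles, I §3.1 and Prop. 3.4] -/
theorem hodgeLie_rigid_of_not_isOfCMType_of_mtRank_le_four (hX : IsSmoothProjective n X.X) (h0 : 0 < X.dim)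
    (hcm : ¬ IsOfCMType X)
    (h4 : haveI := BettiUniverse.finite hX 1; (BettiUniverse.hodge exists_isReal_hodgeModel_holds hX 1).mtRank ≤ 4) :
    haveI := BettiUniverse.finite hX 1
    ∀ 𝔞 : Submodule ℚ (Module.End ℚ (bettiCohomology X.X 1)),
      𝔞 ≤ (BettiUniverse.hodge exists_isReal_hodgeModel_holds hX 1).hodgeLie →
      (∀ A ∈ 𝔞, ∀ B ∈ 𝔞, A * B - B * A ∈ 𝔞) →
      (∃ Θ ∈ Submodule.span ℂ ((fun A : Module.End ℚ (bettiCohomology X.X 1) => A.baseChange ℂ) ''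
          (𝔞 : Set (Module.End ℚ (bettiCohomology X.X 1)))),
        ∀ p, ∀ x ∈ (BettiUniverse.hodge exists_isReal_hodgeModel_holds hX 1).piece p (((1 : ℕ) : ℤ) - p),
          Θ x = ((2 * p - ((1 : ℕ) : ℤ) : ℤ) : ℂ) • x) →
      (BettiUniverse.hodge exists_isReal_hodgeModel_holds hX 1).hodgeLie ≤ 𝔞 := by
  haveI := BettiUniverse.finite hX 1
  obtain ⟨ψ⟩ := BettiUniverse.hodge_isPolarizable exists_isReal_hodgeModel_holds hX 1
  obtain ⟨hne, h3⟩ := not_hodgeLie_le_endAlg_and_finrank_le_three_of_not_isOfCMType hX h0 hcm h4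
  exact rigid_of_finrank_hodgeLie_le_three _ ψ Nat.cast_one
    (BettiUniverse.hodge_isEffective exists_isReal_hodgeModel_holds hX 1) hne h3

/-- **An abelian SURFACE with `End⁰X = ℚ` is `Θ`-rigid** (`Lie Hg(H¹X) = 𝔰𝔭₄`: the tree's `Θ`-subalgebra theorem in symplectic rank
four, `dim_ℚ H¹ = 4`, `End_Hdg(H¹) = ℚ`). [cite: MoonenZarhin1999LowDim, §2 (2.2)] [cite: Deligne1982HodgeCycles, I §3.1 and Prop. 3.4] -/
theorem hodgeLie_rigid_of_surface_of_finrank_endAlgebra_eq_one (hX : IsSmoothProjective n X.X) (hX2 : X.dim = 2)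
    (hE1 : Module.finrank ℚ X.endAlgebra = 1) :
    haveI := BettiUniverse.finite hX 1
    ∀ 𝔞 : Submodule ℚ (Module.End ℚ (bettiCohomology X.X 1)),
      𝔞 ≤ (BettiUniverse.hodge exists_isReal_hodgeModel_holds hX 1).hodgeLie →
      (∀ A ∈ 𝔞, ∀ B ∈ 𝔞, A * B - B * A ∈ 𝔞) →
      (∃ Θ ∈ Submodule.span ℂ ((fun A : Module.End ℚ (bettiCohomology X.X 1) => A.baseChange ℂ) ''
          (𝔞 : Set (Module.End ℚ (bettiCohomology X.X 1)))),
        ∀ p, ∀ x ∈ (BettiUniverse.hodge exists_isReal_hodgeModel_holds hX 1).piece p (((1 : ℕ) : ℤ) - p),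
          Θ x = ((2 * p - ((1 : ℕ) : ℤ) : ℤ) : ℂ) • x) →
      (BettiUniverse.hodge exists_isReal_hodgeModel_holds hX 1).hodgeLie ≤ 𝔞 := by
  have hn : X.dim = n := schemeDim_eq_holds hX
  subst hn
  haveI := BettiUniverse.finite hX 1
  obtain ⟨ψ⟩ := BettiUniverse.hodge_isPolarizable exists_isReal_hodgeModel_holds hX 1
  have hV : Module.finrank ℚ (bettiCohomology X.X 1) = 4 := by rw [finrank_bettiCohomology_one X, hX2]
  exact rigid_of_rankFour_of_endAlg_eq_bot _ ψ Nat.cast_one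
    (BettiUniverse.hodge_isEffective exists_isReal_hodgeModel_holds hX 1)
    (exists_eq_smul_one_of_finrank_endAlgebra_eq_one exists_isReal_hodgeModel_holds hodgePQ_independent_of_hodgeModel_holds
      hE1 (by omega)) hV

/-- **A simple abelian SURFACE with real multiplication (`dim_ℚ End⁰X = 2`) is `Θ`-rigid** (`Lie Hg(H¹X) = 𝔰𝔭_K(H¹, ψ)`,
`Hg = R_{K/ℚ} SL₂`: the tree's `Θ`-subalgebra theorem at the real places, fed with the eigenblock data of
`HodgeTheory/RealMultiplicationHodgeLieAlgebra`). [cite: MoonenZarhin1999LowDim, §2 (2.2)] [cite: Hazama1983, Lemma (3.1)] -/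
theorem hodgeLie_rigid_of_isSimple_surface_of_finrank_endAlgebra_eq_two (hX : IsSmoothProjective n X.X) (hXs : X.IsSimple)
    (hX2 : X.dim = 2) (hE2 : Module.finrank ℚ X.endAlgebra = 2) :
    haveI := BettiUniverse.finite hX 1
    ∀ 𝔞 : Submodule ℚ (Module.End ℚ (bettiCohomology X.X 1)),
      𝔞 ≤ (BettiUniverse.hodge exists_isReal_hodgeModel_holds hX 1).hodgeLie →
      (∀ A ∈ 𝔞, ∀ B ∈ 𝔞, A * B - B * A ∈ 𝔞) →
      (∃ Θ ∈ Submodule.span ℂ ((fun A : Module.End ℚ (bettiCohomology X.X 1) => A.baseChange ℂ) ''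
          (𝔞 : Set (Module.End ℚ (bettiCohomology X.X 1)))),
        ∀ p, ∀ x ∈ (BettiUniverse.hodge exists_isReal_hodgeModel_holds hX 1).piece p (((1 : ℕ) : ℤ) - p),
          Θ x = ((2 * p - ((1 : ℕ) : ℤ) : ℤ) : ℂ) • x) →
      (BettiUniverse.hodge exists_isReal_hodgeModel_holds hX 1).hodgeLie ≤ 𝔞 := by
  classical
  have hn : X.dim = n := schemeDim_eq_holds hX
  subst hn
  haveI := BettiUniverse.finite hX 1
  obtain ⟨ψ⟩ := BettiUniverse.hodge_isPolarizable exists_isReal_hodgeModel_holds hX 1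
  have h0 : 0 < X.dim := by omega
  have hF : IsField X.endAlgebra :=
    Literature.AlgebraicGeometry.HodgeTheory.AbelianVariety.isField_endAlgebra_of_isSimple_of_finrank_eq_two hXs h0 hE2
  haveI : NumberField.IsTotallyReal (EndField X hF) :=
    Literature.AlgebraicGeometry.HodgeTheory.AbelianVariety.isTotallyReal_endField_of_surface hX2 hE2 hF
  have hdeg : Module.finrank ℚ X.endAlgebra = X.dim := by rw [hE2, hX2]
  have hodd : Odd (((1 : ℕ) : ℤ)) := ⟨0, by norm_num⟩
  exact rigid_of_realPlaces _ hodd ψ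
    (isAdjointPair_self_of_isTotallyReal hF exists_isReal_hodgeModel_holds hodgePQ_independent_of_hodgeModel_holds h0 ψ)
    (hodgeCharacter hF exists_isReal_hodgeModel_holds hodgePQ_independent_of_hodgeModel_holds)
    (hodgeCharacter_isReal hF exists_isReal_hodgeModel_holds hodgePQ_independent_of_hodgeModel_holds)
    (isInternal_eigenBlock_hodgeCharacter hF exists_isReal_hodgeModel_holds hodgePQ_independent_of_hodgeModel_holds)
    (finrank_eigenBlock_hodgeCharacter hF exists_isReal_hodgeModel_holds hodgePQ_independent_of_hodgeModel_holds hdeg)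

/-! ## §2 The product theorem -/

/-- **`dim Lie Hg(H¹(X₁ × X₂)) = dim Lie Hg(H¹X₁) + dim Lie Hg(H¹X₂)` for `Θ`-rigid factors with `Lie Hg(H¹X₁)` SIMPLE**, provided
`Lie Hg(H¹X₂)` is simple of another dimension, or semisimple with `dim Lie Hg(H¹X₂) − dim Lie Hg(H¹X₁) ∈ {1, 2, 4, 5, 7}` (then
`Lie Hg(H¹X₂)` has no ideal of codimension `dim Lie Hg(H¹X₁)`, and Goursat's lemma leaves only the full product).  The bicone
`fst`, `snd`, `prodLift 𝟙 0`, `prodLift 0 𝟙` of `X₁.prod X₂` decomposes `H¹(X₁ × X₂) = fst^* H¹(X₁) ⊕ snd^* H¹(X₂)`.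
[cite: MoonenZarhin1999LowDim, §3 (3.1)] [cite: Hazama1983, Lemma (3.1)] -/
theorem finrank_hodgeLie_hodge_one_prod_eq_add_of_rigid (hX₁ : IsSmoothProjective n₁ X₁.X) (hX₂ : IsSmoothProjective n₂ X₂.X)
    {m : ℕ} (hP : IsSmoothProjective m (X₁.prod X₂).X)
    (hrig₁ : haveI := BettiUniverse.finite hX₁ 1
      ∀ 𝔞 : Submodule ℚ (Module.End ℚ (bettiCohomology X₁.X 1)),
        𝔞 ≤ (BettiUniverse.hodge exists_isReal_hodgeModel_holds hX₁ 1).hodgeLie →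
        (∀ A ∈ 𝔞, ∀ B ∈ 𝔞, A * B - B * A ∈ 𝔞) →
        (∃ Θ ∈ Submodule.span ℂ ((fun A : Module.End ℚ (bettiCohomology X₁.X 1) => A.baseChange ℂ) ''
            (𝔞 : Set (Module.End ℚ (bettiCohomology X₁.X 1)))),
          ∀ p, ∀ x ∈ (BettiUniverse.hodge exists_isReal_hodgeModel_holds hX₁ 1).piece p (((1 : ℕ) : ℤ) - p),
            Θ x = ((2 * p - ((1 : ℕ) : ℤ) : ℤ) : ℂ) • x) →
        (BettiUniverse.hodge exists_isReal_hodgeModel_holds hX₁ 1).hodgeLie ≤ 𝔞)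
    (hrig₂ : haveI := BettiUniverse.finite hX₂ 1
      ∀ 𝔞 : Submodule ℚ (Module.End ℚ (bettiCohomology X₂.X 1)),
        𝔞 ≤ (BettiUniverse.hodge exists_isReal_hodgeModel_holds hX₂ 1).hodgeLie →
        (∀ A ∈ 𝔞, ∀ B ∈ 𝔞, A * B - B * A ∈ 𝔞) →
        (∃ Θ ∈ Submodule.span ℂ ((fun A : Module.End ℚ (bettiCohomology X₂.X 1) => A.baseChange ℂ) ''
            (𝔞 : Set (Module.End ℚ (bettiCohomology X₂.X 1)))),
          ∀ p, ∀ x ∈ (BettiUniverse.hodge exists_isReal_hodgeModel_holds hX₂ 1).piece p (((1 : ℕ) : ℤ) - p),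
            Θ x = ((2 * p - ((1 : ℕ) : ℤ) : ℤ) : ℂ) • x) →
        (BettiUniverse.hodge exists_isReal_hodgeModel_holds hX₂ 1).hodgeLie ≤ 𝔞)
    (hs₁ : haveI := BettiUniverse.finite hX₁ 1; letI : LieRing (Module.End ℚ (bettiCohomology X₁.X 1)) := LieRing.ofAssociativeRing
      ∀ 𝔏 : LieSubalgebra ℚ (Module.End ℚ (bettiCohomology X₁.X 1)),
        𝔏.toSubmodule = (BettiUniverse.hodge exists_isReal_hodgeModel_holds hX₁ 1).hodgeLie → LieAlgebra.IsSimple ℚ 𝔏)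
    (halt : haveI := BettiUniverse.finite hX₁ 1; haveI := BettiUniverse.finite hX₂ 1; letI : LieRing (Module.End ℚ (bettiCohomology X₂.X 1)) := LieRing.ofAssociativeRing
      ((∀ 𝔏 : LieSubalgebra ℚ (Module.End ℚ (bettiCohomology X₂.X 1)),
          𝔏.toSubmodule = (BettiUniverse.hodge exists_isReal_hodgeModel_holds hX₂ 1).hodgeLie → LieAlgebra.IsSimple ℚ 𝔏) ∧
        Module.finrank ℚ (BettiUniverse.hodge exists_isReal_hodgeModel_holds hX₁ 1).hodgeLie ≠
          Module.finrank ℚ (BettiUniverse.hodge exists_isReal_hodgeModel_holds hX₂ 1).hodgeLie) ∨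
      ((∀ 𝔏 : LieSubalgebra ℚ (Module.End ℚ (bettiCohomology X₂.X 1)),
          𝔏.toSubmodule = (BettiUniverse.hodge exists_isReal_hodgeModel_holds hX₂ 1).hodgeLie → LieAlgebra.IsSemisimple ℚ 𝔏) ∧
        (Module.finrank ℚ (BettiUniverse.hodge exists_isReal_hodgeModel_holds hX₂ 1).hodgeLie =
            Module.finrank ℚ (BettiUniverse.hodge exists_isReal_hodgeModel_holds hX₁ 1).hodgeLie + 1 ∨
          Module.finrank ℚ (BettiUniverse.hodge exists_isReal_hodgeModel_holds hX₂ 1).hodgeLie =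
            Module.finrank ℚ (BettiUniverse.hodge exists_isReal_hodgeModel_holds hX₁ 1).hodgeLie + 2 ∨
          Module.finrank ℚ (BettiUniverse.hodge exists_isReal_hodgeModel_holds hX₂ 1).hodgeLie =
            Module.finrank ℚ (BettiUniverse.hodge exists_isReal_hodgeModel_holds hX₁ 1).hodgeLie + 4 ∨
          Module.finrank ℚ (BettiUniverse.hodge exists_isReal_hodgeModel_holds hX₂ 1).hodgeLie =
            Module.finrank ℚ (BettiUniverse.hodge exists_isReal_hodgeModel_holds hX₁ 1).hodgeLie + 5 ∨
          Module.finrank ℚ (BettiUniverse.hodge exists_isReal_hodgeModel_holds hX₂ 1).hodgeLie =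
            Module.finrank ℚ (BettiUniverse.hodge exists_isReal_hodgeModel_holds hX₁ 1).hodgeLie + 7))) :
    haveI := BettiUniverse.finite hP 1
    haveI := BettiUniverse.finite hX₁ 1
    haveI := BettiUniverse.finite hX₂ 1
    Module.finrank ℚ (BettiUniverse.hodge exists_isReal_hodgeModel_holds hP 1).hodgeLie =
      Module.finrank ℚ (BettiUniverse.hodge exists_isReal_hodgeModel_holds hX₁ 1).hodgeLie +
        Module.finrank ℚ (BettiUniverse.hodge exists_isReal_hodgeModel_holds hX₂ 1).hodgeLie := by
  haveI := BettiUniverse.finite hP 1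
  haveI := BettiUniverse.finite hX₁ 1
  haveI := BettiUniverse.finite hX₂ 1
  letI : LieRing (Module.End ℚ (bettiCohomology X₁.X 1)) := LieRing.ofAssociativeRing
  letI : LieRing (Module.End ℚ (bettiCohomology X₂.X 1)) := LieRing.ofAssociativeRing
  -- the bicone of `H¹`
  let ι₁ := BettiUniverse.pullHodgeHom exists_isReal_hodgeModel_holds hodgePQ_independent_of_hodgeModel_holds hP hX₁
    (fst X₁ X₂).hom.hom.hom 1
  let π₁ := BettiUniverse.pullHodgeHom exists_isReal_hodgeModel_holds hodgePQ_independent_of_hodgeModel_holds hX₁ hP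
    (prodLift (𝟙 X₁) (0 : X₁ ⟶ X₂)).hom.hom.hom 1
  let ι₂ := BettiUniverse.pullHodgeHom exists_isReal_hodgeModel_holds hodgePQ_independent_of_hodgeModel_holds hP hX₂
    (snd X₁ X₂).hom.hom.hom 1
  let π₂ := BettiUniverse.pullHodgeHom exists_isReal_hodgeModel_holds hodgePQ_independent_of_hodgeModel_holds hX₂ hP
    (prodLift (0 : X₂ ⟶ X₁) (𝟙 X₂)).hom.hom.hom 1
  have hsumP : fst X₁ X₂ ≫ prodLift (𝟙 X₁) (0 : X₁ ⟶ X₂) + snd X₁ X₂ ≫ prodLift (0 : X₂ ⟶ X₁) (𝟙 X₂) = 𝟙 _ := by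
    refine prod_hom_ext ?_ ?_
    · rw [Preadditive.add_comp, Category.assoc, Category.assoc, prodLift_fst, prodLift_fst, Category.comp_id,
        comp_zero, add_zero, Category.id_comp]
    · rw [Preadditive.add_comp, Category.assoc, Category.assoc, prodLift_snd, prodLift_snd, Category.comp_id,
        comp_zero, zero_add, Category.id_comp]
  have hπι₁ : ∀ v, π₁.toLinearMap (ι₁.toLinearMap v) = v := fun v => pull_pull_eq_self_of_comp_eq_id (prodLift_fst _ _) v
  have hπι₂ : ∀ v, π₂.toLinearMap (ι₂.toLinearMap v) = v := fun v => pull_pull_eq_self_of_comp_eq_id (prodLift_snd _ _) v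
  have hsum : ∀ v, ι₁.toLinearMap (π₁.toLinearMap v) + ι₂.toLinearMap (π₂.toLinearMap v) = v := fun v =>
    pull_pull_add_pull_pull_eq_self _ _ _ _ hsumP v
  -- Lie subalgebras with carriers `𝔥(H¹X₁)`, `𝔥(H¹X₂)`
  obtain ⟨𝔏₁, h𝔏₁⟩ := exists_lieSubalgebra_eq_hodgeLie (BettiUniverse.hodge exists_isReal_hodgeModel_holds hX₁ 1)
  obtain ⟨𝔏₂, h𝔏₂⟩ := exists_lieSubalgebra_eq_hodgeLie (BettiUniverse.hodge exists_isReal_hodgeModel_holds hX₂ 1)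
  haveI : LieAlgebra.IsSimple ℚ 𝔏₁ := hs₁ 𝔏₁ h𝔏₁
  rcases halt with ⟨hs₂, hne⟩ | ⟨hss₂, hd⟩
  · haveI : LieAlgebra.IsSimple ℚ 𝔏₂ := hs₂ 𝔏₂ h𝔏₂
    exact finrank_hodgeLie_eq_add_of_rigid_of_isSimple_of_finrank_ne ι₁ π₁ ι₂ π₂ hπι₁ hπι₂ hsum hrig₁ hrig₂ 𝔏₁ h𝔏₁ 𝔏₂ h𝔏₂ hne
  · haveI : LieAlgebra.IsSemisimple ℚ 𝔏₂ := hss₂ 𝔏₂ h𝔏₂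
    exact finrank_hodgeLie_eq_add_of_rigid_of_isSemisimple ι₁ π₁ ι₂ π₂ hπι₁ hπι₂ hsum hrig₁ hrig₂ 𝔏₁ h𝔏₁ 𝔏₂ h𝔏₂ hd

/-! ## §3 Mumford–Tate ranks -/

/-- **`t(X) + 1 = t(X₁) + t(X₂)` for `X ∼ X₁ × X₂` with `Θ`-rigid factors, `Lie Hg(H¹X₁)` simple, and `Lie Hg(H¹X₂)` simple of
another dimension or semisimple with `dim Lie Hg(H¹X₂) − dim Lie Hg(H¹X₁) ∈ {1, 2, 4, 5, 7}`** (`t = dim MT(H¹·) = dim Lie Hg + 1`;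
isogeny invariance of `dim Lie Hg`).  Moonen–Zarhin's `Hg(X₁ × X₂) = Hg(X₁) × Hg(X₂)` for such pairs, in dimensions.
[cite: MoonenZarhin1999LowDim, §3 (3.1)] [cite: Hazama1983, Lemma (3.1)] -/
theorem mtRank_hodge_one_add_one_eq_add_of_isIsogenous_prod_of_rigid (hX : IsSmoothProjective n X.X)
    (hX₁ : IsSmoothProjective n₁ X₁.X) (hX₂ : IsSmoothProjective n₂ X₂.X) (h₁ : 0 < X₁.dim) (h₂ : 0 < X₂.dim)
    (hrig₁ : haveI := BettiUniverse.finite hX₁ 1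
      ∀ 𝔞 : Submodule ℚ (Module.End ℚ (bettiCohomology X₁.X 1)),
        𝔞 ≤ (BettiUniverse.hodge exists_isReal_hodgeModel_holds hX₁ 1).hodgeLie →
        (∀ A ∈ 𝔞, ∀ B ∈ 𝔞, A * B - B * A ∈ 𝔞) →
        (∃ Θ ∈ Submodule.span ℂ ((fun A : Module.End ℚ (bettiCohomology X₁.X 1) => A.baseChange ℂ) ''
            (𝔞 : Set (Module.End ℚ (bettiCohomology X₁.X 1)))),
          ∀ p, ∀ x ∈ (BettiUniverse.hodge exists_isReal_hodgeModel_holds hX₁ 1).piece p (((1 : ℕ) : ℤ) - p),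
            Θ x = ((2 * p - ((1 : ℕ) : ℤ) : ℤ) : ℂ) • x) →
        (BettiUniverse.hodge exists_isReal_hodgeModel_holds hX₁ 1).hodgeLie ≤ 𝔞)
    (hrig₂ : haveI := BettiUniverse.finite hX₂ 1
      ∀ 𝔞 : Submodule ℚ (Module.End ℚ (bettiCohomology X₂.X 1)),
        𝔞 ≤ (BettiUniverse.hodge exists_isReal_hodgeModel_holds hX₂ 1).hodgeLie →
        (∀ A ∈ 𝔞, ∀ B ∈ 𝔞, A * B - B * A ∈ 𝔞) →
        (∃ Θ ∈ Submodule.span ℂ ((fun A : Module.End ℚ (bettiCohomology X₂.X 1) => A.baseChange ℂ) ''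
            (𝔞 : Set (Module.End ℚ (bettiCohomology X₂.X 1)))),
          ∀ p, ∀ x ∈ (BettiUniverse.hodge exists_isReal_hodgeModel_holds hX₂ 1).piece p (((1 : ℕ) : ℤ) - p),
            Θ x = ((2 * p - ((1 : ℕ) : ℤ) : ℤ) : ℂ) • x) →
        (BettiUniverse.hodge exists_isReal_hodgeModel_holds hX₂ 1).hodgeLie ≤ 𝔞)
    (hs₁ : haveI := BettiUniverse.finite hX₁ 1; letI : LieRing (Module.End ℚ (bettiCohomology X₁.X 1)) := LieRing.ofAssociativeRing
      ∀ 𝔏 : LieSubalgebra ℚ (Module.End ℚ (bettiCohomology X₁.X 1)),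
        𝔏.toSubmodule = (BettiUniverse.hodge exists_isReal_hodgeModel_holds hX₁ 1).hodgeLie → LieAlgebra.IsSimple ℚ 𝔏)
    (halt : haveI := BettiUniverse.finite hX₁ 1; haveI := BettiUniverse.finite hX₂ 1; letI : LieRing (Module.End ℚ (bettiCohomology X₂.X 1)) := LieRing.ofAssociativeRing
      ((∀ 𝔏 : LieSubalgebra ℚ (Module.End ℚ (bettiCohomology X₂.X 1)),
          𝔏.toSubmodule = (BettiUniverse.hodge exists_isReal_hodgeModel_holds hX₂ 1).hodgeLie → LieAlgebra.IsSimple ℚ 𝔏) ∧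
        Module.finrank ℚ (BettiUniverse.hodge exists_isReal_hodgeModel_holds hX₁ 1).hodgeLie ≠
          Module.finrank ℚ (BettiUniverse.hodge exists_isReal_hodgeModel_holds hX₂ 1).hodgeLie) ∨
      ((∀ 𝔏 : LieSubalgebra ℚ (Module.End ℚ (bettiCohomology X₂.X 1)),
          𝔏.toSubmodule = (BettiUniverse.hodge exists_isReal_hodgeModel_holds hX₂ 1).hodgeLie → LieAlgebra.IsSemisimple ℚ 𝔏) ∧
        (Module.finrank ℚ (BettiUniverse.hodge exists_isReal_hodgeModel_holds hX₂ 1).hodgeLie =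
            Module.finrank ℚ (BettiUniverse.hodge exists_isReal_hodgeModel_holds hX₁ 1).hodgeLie + 1 ∨
          Module.finrank ℚ (BettiUniverse.hodge exists_isReal_hodgeModel_holds hX₂ 1).hodgeLie =
            Module.finrank ℚ (BettiUniverse.hodge exists_isReal_hodgeModel_holds hX₁ 1).hodgeLie + 2 ∨
          Module.finrank ℚ (BettiUniverse.hodge exists_isReal_hodgeModel_holds hX₂ 1).hodgeLie =
            Module.finrank ℚ (BettiUniverse.hodge exists_isReal_hodgeModel_holds hX₁ 1).hodgeLie + 4 ∨
          Module.finrank ℚ (BettiUniverse.hodge exists_isReal_hodgeModel_holds hX₂ 1).hodgeLie =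
            Module.finrank ℚ (BettiUniverse.hodge exists_isReal_hodgeModel_holds hX₁ 1).hodgeLie + 5 ∨
          Module.finrank ℚ (BettiUniverse.hodge exists_isReal_hodgeModel_holds hX₂ 1).hodgeLie =
            Module.finrank ℚ (BettiUniverse.hodge exists_isReal_hodgeModel_holds hX₁ 1).hodgeLie + 7)))
    (hXP : IsIsogenous X (X₁.prod X₂)) :
    haveI := BettiUniverse.finite hX 1
    haveI := BettiUniverse.finite hX₁ 1
    haveI := BettiUniverse.finite hX₂ 1
    (BettiUniverse.hodge exists_isReal_hodgeModel_holds hX 1).mtRank + 1 =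
      (BettiUniverse.hodge exists_isReal_hodgeModel_holds hX₁ 1).mtRank +
        (BettiUniverse.hodge exists_isReal_hodgeModel_holds hX₂ 1).mtRank := by
  haveI := BettiUniverse.finite hX 1
  haveI := BettiUniverse.finite hX₁ 1
  haveI := BettiUniverse.finite hX₂ 1
  have hP : IsSmoothProjective (X₁.prod X₂).dim (X₁.prod X₂).X := AbelianVariety.isSmoothProjective_holds
  haveI := BettiUniverse.finite hP 1
  have h0 : 0 < X.dim := by
    obtain ⟨f, hf⟩ := hXP
    rw [dim_eq_of_isIsogeny hf, dim_prod]; omega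
  have h := finrank_hodgeLie_hodge_one_prod_eq_add_of_rigid hX₁ hX₂ hP hrig₁ hrig₂ hs₁ halt
  rw [← finrank_hodgeLie_hodge_one_eq_of_isIsogenous hX hP hXP] at h
  rw [mtRank_hodge_one_eq_finrank_hodgeLie_add_one hX h0, mtRank_hodge_one_eq_finrank_hodgeLie_add_one hX₁ h₁,
    mtRank_hodge_one_eq_finrank_hodgeLie_add_one hX₂ h₂]
  omega

/-- **`Lie Hg(H¹X)` is a SIMPLE Lie algebra (a `ℚ`-form of `𝔰𝔩₂`) for `X` without factor of type IV and `dim MT(H¹X) = 4`** (no type IV: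
`𝔷 = 0` and `Lie Hg` semisimple; dimension `3`: simple).  E.g. a non-CM elliptic curve or a QM surface.
[cite: MoonenZarhin1999LowDim, §2 (2.1)–(2.2)] -/
theorem isSimple_hodgeLie_hodge_one_of_hasNoTypeIVFactor_of_mtRank_eq_four (hX : IsSmoothProjective n X.X) (h0 : 0 < X.dim)
    (hA4 : HasNoTypeIVFactor X)
    (h4 : haveI := BettiUniverse.finite hX 1; (BettiUniverse.hodge exists_isReal_hodgeModel_holds hX 1).mtRank = 4) :
    haveI := BettiUniverse.finite hX 1
    letI : LieRing (Module.End ℚ (bettiCohomology X.X 1)) := LieRing.ofAssociativeRing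
    ∀ 𝔏 : LieSubalgebra ℚ (Module.End ℚ (bettiCohomology X.X 1)),
      𝔏.toSubmodule = (BettiUniverse.hodge exists_isReal_hodgeModel_holds hX 1).hodgeLie → LieAlgebra.IsSimple ℚ 𝔏 := by
  haveI := BettiUniverse.finite hX 1
  letI : LieRing (Module.End ℚ (bettiCohomology X.X 1)) := LieRing.ofAssociativeRing
  intro 𝔏 h𝔏
  haveI : LieAlgebra.IsSemisimple ℚ 𝔏 := (isSemisimple_of_eq_hodgeLie_hodge_one_of_hasNoTypeIVFactor hX hA4 𝔏 h𝔏).1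
  haveI : Module.Finite ℚ 𝔏 := Module.Finite.of_injective 𝔏.toSubmodule.subtype Subtype.val_injective
  have h3 : Module.finrank ℚ 𝔏 = 3 := by
    have e : Module.finrank ℚ 𝔏 = Module.finrank ℚ (BettiUniverse.hodge exists_isReal_hodgeModel_holds hX 1).hodgeLie := by
      rw [← h𝔏]; rfl
    have h := mtRank_hodge_one_eq_finrank_hodgeLie_add_one hX h0
    omega
  exact Literature.Algebra.Lie.SemisimpleSmallDimension.isSimple_of_finrank_eq_three h3

/-! ## §4 The general form: no ideal of the critical codimension -/

/-- **General form: `dim Lie Hg(H¹(X₁ × X₂)) = dim Lie Hg(H¹X₁) + dim Lie Hg(H¹X₂)` for `Θ`-rigid factors with `Lie Hg(H¹X₁)` simple, provided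
`Lie Hg(H¹X₂)` has NO Lie ideal of codimension `dim Lie Hg(H¹X₁)`** (the graph case of Goursat's lemma is then impossible).  This is the
form to use for a reductive, non-semisimple second factor (e.g. Ribet type IV: `Lie Hg = 𝔷 ⊕ 𝔰𝔲`, ideals of dimension `0, 1, dim − 1, dim`).
[cite: MoonenZarhin1999LowDim, §3 (3.1)] [cite: Hazama1983, Lemma (3.1)] -/
theorem finrank_hodgeLie_hodge_one_prod_eq_add_of_rigid_of_forall_ideal (hX₁ : IsSmoothProjective n₁ X₁.X)
    (hX₂ : IsSmoothProjective n₂ X₂.X) {m : ℕ} (hP : IsSmoothProjective m (X₁.prod X₂).X)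
    (hrig₁ : haveI := BettiUniverse.finite hX₁ 1
      ∀ 𝔞 : Submodule ℚ (Module.End ℚ (bettiCohomology X₁.X 1)),
        𝔞 ≤ (BettiUniverse.hodge exists_isReal_hodgeModel_holds hX₁ 1).hodgeLie →
        (∀ A ∈ 𝔞, ∀ B ∈ 𝔞, A * B - B * A ∈ 𝔞) →
        (∃ Θ ∈ Submodule.span ℂ ((fun A : Module.End ℚ (bettiCohomology X₁.X 1) => A.baseChange ℂ) ''
            (𝔞 : Set (Module.End ℚ (bettiCohomology X₁.X 1)))),
          ∀ p, ∀ x ∈ (BettiUniverse.hodge exists_isReal_hodgeModel_holds hX₁ 1).piece p (((1 : ℕ) : ℤ) - p),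
            Θ x = ((2 * p - ((1 : ℕ) : ℤ) : ℤ) : ℂ) • x) →
        (BettiUniverse.hodge exists_isReal_hodgeModel_holds hX₁ 1).hodgeLie ≤ 𝔞)
    (hrig₂ : haveI := BettiUniverse.finite hX₂ 1
      ∀ 𝔞 : Submodule ℚ (Module.End ℚ (bettiCohomology X₂.X 1)),
        𝔞 ≤ (BettiUniverse.hodge exists_isReal_hodgeModel_holds hX₂ 1).hodgeLie →
        (∀ A ∈ 𝔞, ∀ B ∈ 𝔞, A * B - B * A ∈ 𝔞) →
        (∃ Θ ∈ Submodule.span ℂ ((fun A : Module.End ℚ (bettiCohomology X₂.X 1) => A.baseChange ℂ) ''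
            (𝔞 : Set (Module.End ℚ (bettiCohomology X₂.X 1)))),
          ∀ p, ∀ x ∈ (BettiUniverse.hodge exists_isReal_hodgeModel_holds hX₂ 1).piece p (((1 : ℕ) : ℤ) - p),
            Θ x = ((2 * p - ((1 : ℕ) : ℤ) : ℤ) : ℂ) • x) →
        (BettiUniverse.hodge exists_isReal_hodgeModel_holds hX₂ 1).hodgeLie ≤ 𝔞)
    (hs₁ : haveI := BettiUniverse.finite hX₁ 1; letI : LieRing (Module.End ℚ (bettiCohomology X₁.X 1)) := LieRing.ofAssociativeRing
      ∀ 𝔏 : LieSubalgebra ℚ (Module.End ℚ (bettiCohomology X₁.X 1)),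
        𝔏.toSubmodule = (BettiUniverse.hodge exists_isReal_hodgeModel_holds hX₁ 1).hodgeLie → LieAlgebra.IsSimple ℚ 𝔏)
    (hno : haveI := BettiUniverse.finite hX₁ 1; haveI := BettiUniverse.finite hX₂ 1; letI : LieRing (Module.End ℚ (bettiCohomology X₂.X 1)) := LieRing.ofAssociativeRing
      ∀ 𝔏 : LieSubalgebra ℚ (Module.End ℚ (bettiCohomology X₂.X 1)),
        𝔏.toSubmodule = (BettiUniverse.hodge exists_isReal_hodgeModel_holds hX₂ 1).hodgeLie →
        ∀ I : LieIdeal ℚ 𝔏, Module.finrank ℚ I + Module.finrank ℚ (BettiUniverse.hodge exists_isReal_hodgeModel_holds hX₁ 1).hodgeLie ≠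
          Module.finrank ℚ (BettiUniverse.hodge exists_isReal_hodgeModel_holds hX₂ 1).hodgeLie) :
    haveI := BettiUniverse.finite hP 1
    haveI := BettiUniverse.finite hX₁ 1
    haveI := BettiUniverse.finite hX₂ 1
    Module.finrank ℚ (BettiUniverse.hodge exists_isReal_hodgeModel_holds hP 1).hodgeLie =
      Module.finrank ℚ (BettiUniverse.hodge exists_isReal_hodgeModel_holds hX₁ 1).hodgeLie +
        Module.finrank ℚ (BettiUniverse.hodge exists_isReal_hodgeModel_holds hX₂ 1).hodgeLie := by
  haveI := BettiUniverse.finite hP 1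
  haveI := BettiUniverse.finite hX₁ 1
  haveI := BettiUniverse.finite hX₂ 1
  letI : LieRing (Module.End ℚ (bettiCohomology X₁.X 1)) := LieRing.ofAssociativeRing
  letI : LieRing (Module.End ℚ (bettiCohomology X₂.X 1)) := LieRing.ofAssociativeRing
  let ι₁ := BettiUniverse.pullHodgeHom exists_isReal_hodgeModel_holds hodgePQ_independent_of_hodgeModel_holds hP hX₁
    (fst X₁ X₂).hom.hom.hom 1
  let π₁ := BettiUniverse.pullHodgeHom exists_isReal_hodgeModel_holds hodgePQ_independent_of_hodgeModel_holds hX₁ hP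
    (prodLift (𝟙 X₁) (0 : X₁ ⟶ X₂)).hom.hom.hom 1
  let ι₂ := BettiUniverse.pullHodgeHom exists_isReal_hodgeModel_holds hodgePQ_independent_of_hodgeModel_holds hP hX₂
    (snd X₁ X₂).hom.hom.hom 1
  let π₂ := BettiUniverse.pullHodgeHom exists_isReal_hodgeModel_holds hodgePQ_independent_of_hodgeModel_holds hX₂ hP
    (prodLift (0 : X₂ ⟶ X₁) (𝟙 X₂)).hom.hom.hom 1
  have hsumP : fst X₁ X₂ ≫ prodLift (𝟙 X₁) (0 : X₁ ⟶ X₂) + snd X₁ X₂ ≫ prodLift (0 : X₂ ⟶ X₁) (𝟙 X₂) = 𝟙 _ := by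
    refine prod_hom_ext ?_ ?_
    · rw [Preadditive.add_comp, Category.assoc, Category.assoc, prodLift_fst, prodLift_fst, Category.comp_id,
        comp_zero, add_zero, Category.id_comp]
    · rw [Preadditive.add_comp, Category.assoc, Category.assoc, prodLift_snd, prodLift_snd, Category.comp_id,
        comp_zero, zero_add, Category.id_comp]
  have hπι₁ : ∀ v, π₁.toLinearMap (ι₁.toLinearMap v) = v := fun v => pull_pull_eq_self_of_comp_eq_id (prodLift_fst _ _) v
  have hπι₂ : ∀ v, π₂.toLinearMap (ι₂.toLinearMap v) = v := fun v => pull_pull_eq_self_of_comp_eq_id (prodLift_snd _ _) v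
  have hsum : ∀ v, ι₁.toLinearMap (π₁.toLinearMap v) + ι₂.toLinearMap (π₂.toLinearMap v) = v := fun v =>
    pull_pull_add_pull_pull_eq_self _ _ _ _ hsumP v
  obtain ⟨𝔏₁, h𝔏₁⟩ := exists_lieSubalgebra_eq_hodgeLie (BettiUniverse.hodge exists_isReal_hodgeModel_holds hX₁ 1)
  obtain ⟨𝔏₂, h𝔏₂⟩ := exists_lieSubalgebra_eq_hodgeLie (BettiUniverse.hodge exists_isReal_hodgeModel_holds hX₂ 1)
  haveI : LieAlgebra.IsSimple ℚ 𝔏₁ := hs₁ 𝔏₁ h𝔏₁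
  rcases finrank_hodgeLie_eq_add_or_exists_ideal_of_rigid ι₁ π₁ ι₂ π₂ hπι₁ hπι₂ hsum hrig₁ hrig₂ 𝔏₁ h𝔏₁ 𝔏₂ h𝔏₂ with h | ⟨-, I, hI⟩
  · exact h
  · exact absurd hI (hno 𝔏₂ h𝔏₂ I)

end Summit.HodgeConjecture.CorCM

end
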